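import Summits.Ventures.PackingBounds.SphericalCodes.TouchingTwoSpheres

/-!
# The `s = 1/3` column (SPLAG Table 9.2, `n = 3 … 10`): current two-sided kernel brackets in code language

Framing: lottery ticket; floor = certified bounds/negative ranges. Venture `PackingBounds` (cell `pub-packcert`), table B2.

The bracket lemmas filed with the attained-side constructions (`Config.CodeThird6.code_dim6_third_bracket`: `32 ≤ · ≤ 35`,
`Config.ConsA.code_dim9_third_bracket`: `96 ≤ · ≤ 99`) predate the cell's sharper kernel upper bounds
`ThreePointCert.C6Td11.code_dim6_third_le_34_sdp` (degree-`11` three-point certificate) and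
`ThreePointCert.C9E.code_dim9_third_le_98` (exact re-solve on the optimal face of the value-`99` program). This file restates
the two brackets with the current kernel upper ends, so that every row of the column has ONE current two-sided statement:

| `n` | bracket in the kernel | statement |
|---|---|---|
| 3 | `= 9` | `Config.CodeThird3.code_dim3_third_exact` |
| 4 | `= 14` | `SphericalCodes.code_dim4_third_isGreatest` |
| 5 | `20 ≤ · ≤ 23` | `Config.CodeThird5.code_dim5_third_bracket` |
| 6 | `32 ≤ · ≤ 34` | `code_dim6_third_bracket_34` (this file) |
| 7 | `= 56` | `Config.Dim7Card56.code_isGreatest` |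
| 8 | `64 ≤ · ≤ 74` | `Config.ConsA.code_dim8_third_bracket` |
| 9 | `96 ≤ · ≤ 98` | `code_dim9_third_bracket_98` (this file) |
| 10 | `104 ≤ · ≤ 135` | `Config.ConsA.code_dim10_third_bracket` |
| 23 | `= 4600` | `Config.Leech.code_dim23_third_isGreatest` |

No new mathematics: conjunctions of existing kernel theorems (the sphere-language versions are
`touching_two_spheres_dim7_bracket` / `touching_two_spheres_dim10_bracket` in `TouchingTwoSpheres`).

## References
* J. H. Conway, N. J. A. Sloane, *Sphere Packings, Lattices and Groups*, 3rd ed., Springer 1999, Ch. 9 Table 9.2.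
  [`ConwaySloane1999`]
* C. Bachoc, F. Vallentin, New upper bounds for kissing numbers from semidefinite programming, J. Amer. Math. Soc. 21 (2008),
  Theorem 4.2 / Table 5.2. [`BachocVallentin2007`]
-/

namespace Summit.Ventures.PackingBounds.SphericalCodes

/-- **`32 ≤ A(6, arccos 1/3) ≤ 34` in the kernel**: the `E₇` section (`Config.CodeThird6.exists_code_32`) and the cell's
degree-`11` three-point certificate `ThreePointCert.C6Td11.code_dim6_third_le_34_sdp` (below Bachoc–Vallentin's printed `35`).
[cite: ConwaySloane1999, Ch. 9 Table 9.2] [cite: BachocVallentin2007, Theorem 4.2] -/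
theorem code_dim6_third_bracket_34 :
    (∃ C : Finset (EuclideanSpace ℝ (Fin 6)), C.card = 32 ∧ (∀ x ∈ C, ‖x‖ = 1) ∧
      (∀ x ∈ C, ∀ y ∈ C, x ≠ y → inner ℝ x y ≤ 1 / 3)) ∧
    ∀ C : Finset (EuclideanSpace ℝ (Fin 6)), (∀ x ∈ C, ‖x‖ = 1) →
      (∀ x ∈ C, ∀ y ∈ C, x ≠ y → inner ℝ x y ≤ 1 / 3) → C.card ≤ 34 :=
  ⟨Config.CodeThird6.exists_code_32, ThreePointCert.C6Td11.code_dim6_third_le_34_sdp⟩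

/-- **`96 ≤ A(9, arccos 1/3) ≤ 98` in the kernel**: Construction A from the Steiner system `S(3,4,10)`
(`Config.ConsA.exists_code_third_96`) and the cell's equality-case exclusion at the three-point value `99`
(`ThreePointCert.C9E.code_dim9_third_le_98`; below Bachoc–Vallentin's printed `99`).
[cite: ConwaySloane1999, Ch. 9 Table 9.2] [cite: BachocVallentin2007, Theorem 4.2] -/
theorem code_dim9_third_bracket_98 :
    (∃ C : Finset (EuclideanSpace ℝ (Fin 9)), C.card = 96 ∧ (∀ x ∈ C, ‖x‖ = 1) ∧
      (∀ x ∈ C, ∀ y ∈ C, x ≠ y → inner ℝ x y ≤ 1 / 3)) ∧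
    ∀ C : Finset (EuclideanSpace ℝ (Fin 9)), (∀ x ∈ C, ‖x‖ = 1) →
      (∀ x ∈ C, ∀ y ∈ C, x ≠ y → inner ℝ x y ≤ 1 / 3) → C.card ≤ 98 :=
  ⟨Config.ConsA.exists_code_third_96, ThreePointCert.C9E.code_dim9_third_le_98⟩

end Summit.Ventures.PackingBounds.SphericalCodes
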